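import Summits.AtomisticToContinuum.BoseEinsteinCondensation.Theorems.BECInsertionCorrectorStaticResponseBoundEcsfOfHyperuniformity
import Summits.AtomisticToContinuum.BoseEinsteinCondensation.Theorems.StaticResponseBound.Negative.SoftenedModeHyperuniformityOfEcsf
import HarnessLib

/-!
# Stub A ⟺ ECSF for line `stable-fraction-square-completion` (crux `StaticResponseBound`, stmt-AtomisticToContinuum-12057)

Supports (does not close) stmt-AtomisticToContinuum-12057.  One named kernel fact joining the lead's
C1 `…StableFractionSquareCompletion.stub_ecsf_of_hyperuniformity` (A ⟹ ECSF, p81508) and the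
drefute-g4 converse `Negative.stub_softenedModeHyperuniformity_of_ecsf` (ECSF ⟹ A, p83834):
the registered text of stub A (softened-mode hyperuniformity of near-minimisers) and the registered
text of the energy-controlled structure factor are EQUIVALENT propositions.  Reading: the line
`stable-fraction-square-completion` is exactly `ECSF ∧ SectorFloor ⟹ StaticResponseBoundPhonon`;
the softening device is inessential.  No new definitions.
-/

namespace Summit.AtomisticToContinuum.BoseEinsteinCondensation.Theorems.StaticResponseBound.Negative

open MeasureTheory
open scoped ENNReal
open Literature.MathematicalPhysics.QuantumManyBody.BoseGas
open Summit.AtomisticToContinuum.BoseEinsteinCondensation.Theses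

noncomputable section

/-- **A ↔ ECSF** (registered texts of the line `stable-fraction-square-completion`): softened-mode
hyperuniformity of the near-minimisers of `E − (θg_p/L³)(⟨|ρ̂_p|²⟩ − N)` for SOME `θ > 0` is
equivalent to the all-states energy-controlled structure factor for SOME `θ > 0`. [folklore] -/
theorem stub_softenedModeHyperuniformity_iff_ecsf :
    (∀ v : ℝ → ℝ≥0∞, IsRepulsiveFiniteRange v → ∀ M₀ : ℝ, 0 < M₀ →
      ∃ ρ₀ : ℝ, 0 < ρ₀ ∧ ∃ θ : ℝ, 0 < θ ∧ ∃ C_H : ℝ, 0 ≤ C_H ∧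
        ∀ ρ : ℝ, 0 < ρ → ρ < ρ₀ → ∀ N : ℕ, 0 < N → ∀ k : Fin 3 → ℤ, k ≠ 0 →
          psq (sideLength ρ N) k ≤ M₀ ^ 2 * (ρ * (scatteringLength v).toReal) →
          ∃ δ : ℝ, 0 < δ ∧ ∀ Φ : PeriodicTrialState N (sideLength ρ N),
            (periodicEnergy v Φ ≠ ⊤ ∧
              ∀ Φ' : PeriodicTrialState N (sideLength ρ N), periodicEnergy v Φ' ≠ ⊤ →
                (periodicEnergy v Φ).toReal -
                    θ * (8 * Real.pi * (scatteringLength v).toReal +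
                        psq (sideLength ρ N) k / (2 * ρ)) / sideLength ρ N ^ 3 *
                      ((∫ X in cellN N (sideLength ρ N),
                          ‖densityWave N (sideLength ρ N) k X‖ ^ 2 * ‖Φ.ψ X‖ ^ 2) - N) ≤
                  (periodicEnergy v Φ').toReal -
                    θ * (8 * Real.pi * (scatteringLength v).toReal +
                        psq (sideLength ρ N) k / (2 * ρ)) / sideLength ρ N ^ 3 *
                      ((∫ X in cellN N (sideLength ρ N),
                          ‖densityWave N (sideLength ρ N) k X‖ ^ 2 * ‖Φ'.ψ X‖ ^ 2) - N) + δ) →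
            (∫ X in cellN N (sideLength ρ N),
                ‖densityWave N (sideLength ρ N) k X‖ ^ 2 * ‖Φ.ψ X‖ ^ 2) ≤
              C_H * N * Real.sqrt (psq (sideLength ρ N) k) /
                Real.sqrt (ρ * (scatteringLength v).toReal)) ↔
    (∀ v : ℝ → ℝ≥0∞, IsRepulsiveFiniteRange v → ∀ M₀ : ℝ, 0 < M₀ →
      ∃ ρ₀ : ℝ, 0 < ρ₀ ∧ ∃ θ : ℝ, 0 < θ ∧ ∃ C_H : ℝ, 0 ≤ C_H ∧
        ∀ ρ : ℝ, 0 < ρ → ρ < ρ₀ → ∀ N : ℕ, 0 < N → ∀ k : Fin 3 → ℤ, k ≠ 0 →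
          psq (sideLength ρ N) k ≤ M₀ ^ 2 * (ρ * (scatteringLength v).toReal) →
          ∀ Φ : PeriodicTrialState N (sideLength ρ N), periodicEnergy v Φ ≠ ⊤ →
            θ * (8 * Real.pi * (scatteringLength v).toReal + psq (sideLength ρ N) k / (2 * ρ)) /
                sideLength ρ N ^ 3 *
                (∫ X in cellN N (sideLength ρ N),
                  ‖densityWave N (sideLength ρ N) k X‖ ^ 2 * ‖Φ.ψ X‖ ^ 2) ≤
              (periodicEnergy v Φ).toReal - (periodicGroundStateEnergy v N (sideLength ρ N)).toReal +
                θ * (8 * Real.pi * (scatteringLength v).toReal + psq (sideLength ρ N) k / (2 * ρ)) /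
                  sideLength ρ N ^ 3 *
                  (C_H * N * Real.sqrt (psq (sideLength ρ N) k) /
                    Real.sqrt (ρ * (scatteringLength v).toReal))) :=
  ⟨Cruxes.StaticResponseBound.StableFractionSquareCompletion.stub_ecsf_of_hyperuniformity,
    stub_softenedModeHyperuniformity_of_ecsf⟩

end

end Summit.AtomisticToContinuum.BoseEinsteinCondensation.Theorems.StaticResponseBound.Negative
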